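import Summits.HodgeConjecture.HodgeConjecture.Theorems.PadicSemiregularLiftFormalLiftingFromClassLiftingTowerCocycles

/-!
# `FormalLiftingFromClassLifting` (stmt-HodgeConjecture-13825) · line `IdeatorFiveSketch` ·
# presenting a class dying on the special fibre by a datum `≡ 1 (mod p)`

Support file for stub S4 `stub_picKernelLift` ((2_Pic)) of the weight-one-first skeleton (lead
prover-line-stmt-HodgeConjecture-13825-c1-0): a class `u ∈ Ȟ¹(X_{n+1}, 𝒪^×)` whose restriction to
the special fibre `X_k` is trivial is presented (`exists_presentation_of_pullback_eq_one`) by a datum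
`(A, W)` on affine opens of `𝒳` (empty on `X_{n+1}` away from the special fibre) whose values are
`≡ 1 (mod p)`: choose a representative cocycle `g`, a coboundary `λ` trivialising `g|_{X_k}`, lift
the `λ_x` to units `λ̂_x` on `X_{n+1}` over small affine opens of `𝒳`, and lift
`λ̂_x g_{xy} λ̂_y⁻¹` to functions `W_{xy}` on `𝒳`. Everything is proved; no definitions.
-/

set_option linter.dupNamespace false

namespace Summit.HodgeConjecture.HodgeConjecture.Theorems.FormalLiftingFromClassLifting.WeightOne

open CategoryTheory AlgebraicGeometry Limits Opposite TopologicalSpace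
open Literature.AlgebraicGeometry Literature.AlgebraicGeometry.Motives
open Literature.AlgebraicGeometry.Motives.WittScheme
open Literature.AlgebraicGeometry.Modules (CechPic UnitCocycle)
open Summit.HodgeConjecture.HodgeConjecture.Theorems.FormalVectorBundlesAlgebraize
  (thickeningι_cutOut isClosedImmersion_thickeningι)

noncomputable section

variable {p : ℕ} [Fact p.Prime] {k : Type} [Field k] (𝒳 : SchemeOver (WittVector p k))

/-- An open of `X_{n+1}` is the preimage of an open of `𝒳` (`X_{n+1} ↪ 𝒳` is an embedding). -/
theorem exists_open_eq_preimage_thickeningι (n : ℕ) (O : (thickening 𝒳 n).left.Opens) :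
    ∃ O' : 𝒳.left.Opens, (thickeningι 𝒳 n) ⁻¹ᵁ O' = O := by
  haveI := isClosedImmersion_thickeningι 𝒳 n
  obtain ⟨t, ht, htO⟩ := (thickeningι 𝒳 n).isClosedEmbedding.isOpen_iff.mp O.2
  exact ⟨⟨t, ht⟩, Opens.ext htO⟩

/-- An open of `X_k` is the preimage of an open of `X_{n+1}` (`X_k ↪ X_{n+1}` is an embedding). -/
theorem exists_open_eq_preimage_specialFibreToThickening [CharP k p] (n : ℕ)
    (O : (specialFibre 𝒳).left.Opens) :
    ∃ O' : (thickening 𝒳 (n + 1)).left.Opens, (specialFibreToThickening 𝒳 n) ⁻¹ᵁ O' = O := by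
  haveI := PadicPridhamSemiregularity.isClosedImmersion_specialFibreToThickening' 𝒳 n
  obtain ⟨t, ht, htO⟩ := (specialFibreToThickening 𝒳 n).isClosedEmbedding.isOpen_iff.mp O.2
  exact ⟨⟨t, ht⟩, Opens.ext htO⟩

/-- The trivial cocycle has transition functions `1`. -/
theorem UnitCocycle.one_g {X : Scheme.{0}} (x y : X) (V : X.Opens) (hx : V ≤ (UnitCocycle.one X).U x)
    (hy : V ≤ (UnitCocycle.one X).U y) : (UnitCocycle.one X).g x y V hx hy = 1 := rfl

/-- The relation of a coboundary from a pulled-back cocycle to the trivial one: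
`λ_x (s^*g)_{xy} = λ_y`. -/
theorem UnitCocycle.coboundary_one_rel {X Y : Scheme.{0}} (s : Y ⟶ X) (g : UnitCocycle X)
    (cb : UnitCocycle.Coboundary (UnitCocycle.pullback s g) (UnitCocycle.one Y)) (x y : Y)
    (V : Y.Opens) (hx : V ≤ cb.W x) (hy : V ≤ cb.W y) :
    cb.lam x V hx * (UnitCocycle.pullback s g).g x y V (hx.trans (cb.le x)) (hy.trans (cb.le y)) =
      cb.lam y V hy := by
  have h := cb.rel x y V hx hy
  rw [UnitCocycle.one_g, one_mul] at h
  exact h.symm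

set_option maxHeartbeats 1600000 in
-- one long construction-cum-verification; the budget is spent on many small rewrites over the
-- sections of the thickenings (pull-back schemes), not on any single search
/-- **Presentation of a class dying on the special fibre.** For `𝒳` separated over `W(k)` and
`u ∈ Ȟ¹(X_{n+1}, 𝒪^×)` with `u|_{X_k} = 1`, there is a datum `(A, W)` — affine opens `A_x ∋ x` of `𝒳`,
disjoint from the special fibre when `x` is, and `W_{xy} ∈ Γ(𝒳, A_x ∩ A_y)` — presenting a cocycle on
`X_{n+1}` (cocycle identity and `W_{xx} ↦ 1` after restriction to `X_{n+1}`), with every `W_{xy}`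
of the form `1 + p w`, such that every cocycle built from it (as in `exists_cocycle_of_datum`) has
class `u`. [folklore] -/
theorem exists_presentation_of_pullback_eq_one [CharP k p] [PerfectRing k p] [IsSeparated 𝒳.hom]
    (n : ℕ)
    (u : CechPic (thickening 𝒳 (n + 1)).left)
    (hu : CechPic.pullback (specialFibreToThickening 𝒳 n) u = 1) :
    ∃ (A : 𝒳.left → 𝒳.left.Opens) (_ : ∀ x, x ∈ A x) (_ : ∀ x, IsAffineOpen (A x))
      (_ : ∀ x, x ∉ Set.range (thickeningι 𝒳 (n + 1)).base →
        ∀ q ∈ A x, q ∉ Set.range (thickeningι 𝒳 (n + 1)).base)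
      (W : ∀ x y : 𝒳.left, Γ(𝒳.left, A x ⊓ A y)),
      (∀ x y z : 𝒳.left,
        (thickeningι 𝒳 (n + 1)).app (A x ⊓ A y ⊓ A z)
          (𝒳.left.presheaf.map (homOfLE inf_le_left).op (W x y) *
            𝒳.left.presheaf.map
              (homOfLE (le_inf (inf_le_left.trans inf_le_right) inf_le_right)).op (W y z)) =
        (thickeningι 𝒳 (n + 1)).app (A x ⊓ A y ⊓ A z)
          (𝒳.left.presheaf.map
            (homOfLE (le_inf (inf_le_left.trans inf_le_left) inf_le_right)).op (W x z))) ∧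
      (∀ x : 𝒳.left, (thickeningι 𝒳 (n + 1)).app (A x ⊓ A x) (W x x) = 1) ∧
      (∀ x y : 𝒳.left, ∃ w : Γ(𝒳.left, A x ⊓ A y), W x y = 1 + (p : Γ(𝒳.left, A x ⊓ A y)) * w) ∧
      ∀ (C : UnitCocycle (thickening 𝒳 (n + 1)).left)
        (hU : ∀ z, C.U z = (thickeningι 𝒳 (n + 1)) ⁻¹ᵁ A ((thickeningι 𝒳 (n + 1)).base z)),
        (∀ (z z' : (thickening 𝒳 (n + 1)).left) (V : (thickening 𝒳 (n + 1)).left.Opens)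
          (hz : V ≤ C.U z) (hz' : V ≤ C.U z'),
          C.g z z' V hz hz' = (thickeningι 𝒳 (n + 1)).appLE
            (A ((thickeningι 𝒳 (n + 1)).base z) ⊓ A ((thickeningι 𝒳 (n + 1)).base z')) V
            (UnitCocycle.le_preimage_inf _ (hz.trans (hU z).le) (hz'.trans (hU z').le))
            (W ((thickeningι 𝒳 (n + 1)).base z) ((thickeningι 𝒳 (n + 1)).base z'))) →
        CechPic.mk C = u := by
  classical
  set ι := thickeningι 𝒳 (n + 1) with hι
  set s := specialFibreToThickening 𝒳 n with hs
  haveI := isClosedImmersion_thickeningι 𝒳 (n + 1)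
  haveI := PadicPridhamSemiregularity.isClosedImmersion_specialFibreToThickening' 𝒳 n
  have hιinj : Function.Injective ι.base := ι.isClosedEmbedding.injective
  have hsinj : Function.Injective s.base := s.isClosedEmbedding.injective
  have hssurj : Function.Surjective s.base := surjective_specialFibreToThickening_base 𝒳 n
  -- a representative and the coboundary trivialising it on `X_k`
  obtain ⟨g, rfl⟩ := CechPic.mk_surjective u
  rw [CechPic.pullback_mk] at hu
  obtain ⟨cb⟩ : UnitCocycle.Equiv (UnitCocycle.pullback s g) (UnitCocycle.one _) :=
    (CechPic.mk_eq_mk_iff _ _).mp hu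
  -- the special fibre inside `𝒳`
  set S : Set 𝒳.left := Set.range ι.base with hS
  have hSclosed : IsClosed S := ι.isClosedEmbedding.isClosed_range
  -- (1) the affine opens `A x`
  have hA : ∀ x : 𝒳.left, ∃ Ax : 𝒳.left.Opens, x ∈ Ax ∧ IsAffineOpen Ax ∧
      (x ∉ S → ∀ q ∈ Ax, q ∉ S) ∧
      ∀ z : (thickening 𝒳 (n + 1)).left, ι.base z = x →
        ι ⁻¹ᵁ Ax ≤ g.U z ∧ ∀ z₀ : (specialFibre 𝒳).left, s.base z₀ = z → s ⁻¹ᵁ (ι ⁻¹ᵁ Ax) ≤ cb.W z₀ := by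
    intro x
    by_cases hx : x ∈ S
    · obtain ⟨z, rfl⟩ := hx
      obtain ⟨z₀, rfl⟩ := hssurj z
      obtain ⟨O₁, hO₁⟩ := exists_open_eq_preimage_thickeningι 𝒳 (n + 1) (g.U (s.base z₀))
      obtain ⟨O₂', hO₂'⟩ := exists_open_eq_preimage_specialFibreToThickening 𝒳 n (cb.W z₀)
      obtain ⟨O₂, hO₂⟩ := exists_open_eq_preimage_thickeningι 𝒳 (n + 1) O₂'
      have hx₁ : ι.base (s.base z₀) ∈ O₁ := by
        have := g.mem (s.base z₀)
        rw [← hO₁] at this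
        exact this
      have hx₂ : ι.base (s.base z₀) ∈ O₂ := by
        have := cb.mem z₀
        rw [← hO₂', ← hO₂] at this
        exact this
      obtain ⟨Ax, hAx, hxAx, hle⟩ := Opens.isBasis_iff_nbhd.mp 𝒳.left.isBasis_affineOpens
        (show ι.base (s.base z₀) ∈ O₁ ⊓ O₂ from ⟨hx₁, hx₂⟩)
      refine ⟨Ax, hxAx, hAx, fun h => absurd ⟨_, rfl⟩ h, ?_⟩
      rintro z hz
      obtain rfl : z = s.base z₀ := hιinj hz
      refine ⟨?_, ?_⟩
      · rw [← hO₁]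
        exact fun q hq => hle.trans inf_le_left hq
      · rintro z₁ hz₁
        obtain rfl : z₁ = z₀ := hsinj hz₁
        rw [← hO₂', ← hO₂]
        exact fun q hq => hle.trans inf_le_right hq
    · obtain ⟨Ax, hAx, hxAx, hle⟩ := Opens.isBasis_iff_nbhd.mp 𝒳.left.isBasis_affineOpens
        (show x ∈ (⟨Sᶜ, hSclosed.isOpen_compl⟩ : 𝒳.left.Opens) from hx)
      refine ⟨Ax, hxAx, hAx, fun _ q hq hqS => hle hq hqS, ?_⟩
      rintro z rfl
      exact absurd ⟨z, rfl⟩ hx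
  choose A hxA hAaff hAgen hAspec using hA
  have hVaff : ∀ x, IsAffineOpen (ι ⁻¹ᵁ A x) := fun x => isAffineOpen_preimage_thickeningι 𝒳 _ (hAaff x)
  -- (2) units `λ̂_x` on `X_{n+1}` over `ι⁻¹ A_x` lifting the coboundary
  have hlam : ∀ x : 𝒳.left, ∃ lam : Γ((thickening 𝒳 (n + 1)).left, ι ⁻¹ᵁ A x), IsUnit lam ∧
      ∀ (z₀ : (specialFibre 𝒳).left) (hz : ι.base (s.base z₀) = x),
        s.app (ι ⁻¹ᵁ A x) lam = cb.lam z₀ (s ⁻¹ᵁ (ι ⁻¹ᵁ A x)) ((hAspec x _ hz).2 z₀ rfl) := by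
    intro x
    by_cases hx : ∃ z₀ : (specialFibre 𝒳).left, ι.base (s.base z₀) = x
    · obtain ⟨z₀, hz₀⟩ := hx
      have hV₀ : s ⁻¹ᵁ (ι ⁻¹ᵁ A x) ≤ cb.W z₀ := (hAspec x _ hz₀).2 z₀ rfl
      obtain ⟨lam, hlam⟩ := app_specialFibreToThickening_surjective 𝒳 n (hVaff x) (cb.lam z₀ _ hV₀)
      obtain ⟨lam', hlam'⟩ := app_specialFibreToThickening_surjective 𝒳 n (hVaff x) (cb.inv z₀ _ hV₀)
      have h0 : s.app (ι ⁻¹ᵁ A x) (lam * lam' - 1) = 0 := by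
        rw [map_sub, map_mul, hlam, hlam', cb.lam_mul_inv, map_one, sub_self]
      obtain ⟨c, hc⟩ := exists_eq_p_mul_of_app_specialFibreToThickening_eq_zero 𝒳 n (hVaff x) _ h0
      refine ⟨lam, isUnit_of_mul_isUnit_left (?_ : IsUnit (lam * lam')), fun z₁ hz₁ => ?_⟩
      · rw [show lam * lam' = 1 + (p : Γ((thickening 𝒳 (n + 1)).left, ι ⁻¹ᵁ A x)) * c by
          rw [← hc]; ring]
        exact isUnit_one_add_p_mul 𝒳 (n + 1) c
      · obtain rfl : z₁ = z₀ := hsinj (hιinj (hz₁.trans hz₀.symm))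
        exact hlam
    · exact ⟨1, isUnit_one, fun z₀ hz₀ => absurd ⟨z₀, hz₀⟩ hx⟩
  choose lam hlamU hlamspec using hlam
  -- the chosen inverses
  set laminv : ∀ x : 𝒳.left, Γ((thickening 𝒳 (n + 1)).left, ι ⁻¹ᵁ A x) :=
    fun x => (↑(hlamU x).unit⁻¹ : Γ((thickening 𝒳 (n + 1)).left, ι ⁻¹ᵁ A x)) with hlaminv
  have hlaminv_mul : ∀ x, laminv x * lam x = 1 := fun x => (hlamU x).val_inv_mul
  have hmul_laminv : ∀ x, lam x * laminv x = 1 := fun x => (hlamU x).mul_val_inv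
  -- (3) the functions `W_{xy}` on `𝒳`
  have hle₁ : ∀ x y : 𝒳.left, ι ⁻¹ᵁ (A x ⊓ A y) ≤ ι ⁻¹ᵁ A x := fun x y q hq => hq.1
  have hle₂ : ∀ x y : 𝒳.left, ι ⁻¹ᵁ (A x ⊓ A y) ≤ ι ⁻¹ᵁ A y := fun x y q hq => hq.2
  have hW : ∀ x y : 𝒳.left, ∃ Wxy : Γ(𝒳.left, A x ⊓ A y),
      (∀ (z z' : (thickening 𝒳 (n + 1)).left) (hz : ι.base z = x) (hz' : ι.base z' = y),
        ι.app (A x ⊓ A y) Wxy =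
          (thickening 𝒳 (n + 1)).left.presheaf.map (homOfLE (hle₁ x y)).op (lam x) *
            g.g z z' (ι ⁻¹ᵁ (A x ⊓ A y)) ((hle₁ x y).trans (hAspec x z hz).1)
              ((hle₂ x y).trans (hAspec y z' hz').1) *
            (thickening 𝒳 (n + 1)).left.presheaf.map (homOfLE (hle₂ x y)).op (laminv y)) ∧
      ((¬ ∃ z, ι.base z = x) ∨ (¬ ∃ z', ι.base z' = y) → Wxy = 1) := by
    intro x y
    by_cases h : (∃ z, ι.base z = x) ∧ (∃ z', ι.base z' = y)
    · obtain ⟨⟨z₁, hz₁⟩, ⟨z₂, hz₂⟩⟩ := h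
      obtain ⟨Wxy, hWxy⟩ := (thickeningι_cutOut 𝒳 (n + 1) (isAffineOpen_inf 𝒳 (hAaff x) (hAaff y))).1
        ((thickening 𝒳 (n + 1)).left.presheaf.map (homOfLE (hle₁ x y)).op (lam x) *
          g.g z₁ z₂ (ι ⁻¹ᵁ (A x ⊓ A y)) ((hle₁ x y).trans (hAspec x z₁ hz₁).1)
            ((hle₂ x y).trans (hAspec y z₂ hz₂).1) *
          (thickening 𝒳 (n + 1)).left.presheaf.map (homOfLE (hle₂ x y)).op (laminv y))
      refine ⟨Wxy, fun z z' hz hz' => ?_, fun hnot => ?_⟩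
      · obtain rfl : z = z₁ := hιinj (hz.trans hz₁.symm)
        obtain rfl : z' = z₂ := hιinj (hz'.trans hz₂.symm)
        exact hWxy
      · exact absurd ⟨z₁, hz₁⟩ (hnot.elim id fun h' _ => h' ⟨z₂, hz₂⟩)
    · exact ⟨1, fun z z' hz hz' => absurd ⟨⟨z, hz⟩, ⟨z', hz'⟩⟩ h, fun _ => rfl⟩
  choose W hWspec hWone using hW
  -- bookkeeping: restriction of a restriction, naturality of `ι` on sections, empty opens
  have res_res : ∀ {U V V' : (thickening 𝒳 (n + 1)).left.Opens} (i : V ≤ U) (j : V' ≤ V)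
      (a : Γ((thickening 𝒳 (n + 1)).left, U)),
      (thickening 𝒳 (n + 1)).left.presheaf.map (homOfLE j).op
        ((thickening 𝒳 (n + 1)).left.presheaf.map (homOfLE i).op a) =
      (thickening 𝒳 (n + 1)).left.presheaf.map (homOfLE (j.trans i)).op a := by
    intro U V V' i j a
    rw [← CategoryTheory.comp_apply, ← Functor.map_comp]
    rfl
  have nat : ∀ {U U' : 𝒳.left.Opens} (i : U' ≤ U) (a : Γ(𝒳.left, U)),
      ι.app U' (𝒳.left.presheaf.map (homOfLE i).op a) =
        (thickening 𝒳 (n + 1)).left.presheaf.map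
          (homOfLE (show ι ⁻¹ᵁ U' ≤ ι ⁻¹ᵁ U from fun q hq => i hq)).op (ι.app U a) := by
    intro U U' i a
    rw [← CategoryTheory.comp_apply, ← CategoryTheory.comp_apply, ι.naturality (homOfLE i).op]
    rfl
  have hsub : ∀ (U : 𝒳.left.Opens) (x : 𝒳.left), (¬ ∃ z, ι.base z = x) → U ≤ A x →
      Subsingleton Γ((thickening 𝒳 (n + 1)).left, ι ⁻¹ᵁ U) := fun U x hx hU =>
    subsingleton_sections_preimage 𝒳 (n + 1) U fun q hq => hAgen x (fun ⟨z, hz⟩ => hx ⟨z, hz⟩) q (hU hq)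
  refine ⟨A, hxA, hAaff, hAgen, W, ?_, ?_, ?_, ?_⟩
  · -- the cocycle identity on `X_{n+1}`
    intro x y z
    by_cases hall : (∃ z₁, ι.base z₁ = x) ∧ (∃ z₂, ι.base z₂ = y) ∧ (∃ z₃, ι.base z₃ = z)
    · obtain ⟨⟨z₁, hz₁⟩, ⟨z₂, hz₂⟩, ⟨z₃, hz₃⟩⟩ := hall
      set V₃ := ι ⁻¹ᵁ (A x ⊓ A y ⊓ A z) with hV₃
      have ex : V₃ ≤ ι ⁻¹ᵁ A x := fun q hq => hq.1.1
      have ey : V₃ ≤ ι ⁻¹ᵁ A y := fun q hq => hq.1.2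
      have ez : V₃ ≤ ι ⁻¹ᵁ A z := fun q hq => hq.2
      rw [map_mul, nat, nat, nat, hWspec x y z₁ z₂ hz₁ hz₂, hWspec y z z₂ z₃ hz₂ hz₃,
        hWspec x z z₁ z₃ hz₁ hz₃]
      simp only [map_mul, res_res]
      rw [g.map_g, g.map_g, g.map_g,
        ← g.g_mul z₁ z₂ z₃ V₃ (ex.trans (hAspec x z₁ hz₁).1) (ey.trans (hAspec y z₂ hz₂).1)
          (ez.trans (hAspec z z₃ hz₃).1)]
      have h1 : (thickening 𝒳 (n + 1)).left.presheaf.map (homOfLE ey).op (laminv y) *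
          (thickening 𝒳 (n + 1)).left.presheaf.map (homOfLE ey).op (lam y) = 1 := by
        rw [← map_mul, hlaminv_mul, map_one]
      rw [show ∀ a b c d e f : Γ((thickening 𝒳 (n + 1)).left, V₃),
          a * b * c * (d * e * f) = a * (c * d) * (b * e) * f from fun _ _ _ _ _ _ => by ring, h1]
      ring
    · -- some index is off the special fibre: the identity lives in a trivial ring
      have : Subsingleton Γ((thickening 𝒳 (n + 1)).left, ι ⁻¹ᵁ (A x ⊓ A y ⊓ A z)) := by
        simp only [not_and_or] at hall
        rcases hall with hx | hy | hz
        · exact hsub _ x hx (inf_le_left.trans inf_le_left)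
        · exact hsub _ y hy (inf_le_left.trans inf_le_right)
        · exact hsub _ z hz inf_le_right
      exact Subsingleton.elim _ _
  · -- `W_{xx} ↦ 1`
    intro x
    by_cases hx : ∃ z, ι.base z = x
    · obtain ⟨z, hz⟩ := hx
      rw [hWspec x x z z hz hz, g.g_self, mul_one, ← map_mul, hmul_laminv, map_one]
    · rw [hWone x x (Or.inl hx), map_one]
  · -- `W_{xy} ≡ 1 (mod p)`: its restriction to `X_{n+1}` restricts to `1` on `X_k`
    intro x y
    by_cases h : (∃ z, ι.base z = x) ∧ (∃ z', ι.base z' = y)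
    · obtain ⟨⟨z₁, hz₁⟩, ⟨z₂, hz₂⟩⟩ := h
      obtain ⟨z₀, rfl⟩ := hssurj z₁
      obtain ⟨z₀', rfl⟩ := hssurj z₂
      set V := ι ⁻¹ᵁ (A x ⊓ A y) with hV
      have hVaffxy : IsAffineOpen V := isAffineOpen_preimage_thickeningι 𝒳 _
        (isAffineOpen_inf 𝒳 (hAaff x) (hAaff y))
      -- naturality of `s` on sections
      have nats : ∀ {U U' : (thickening 𝒳 (n + 1)).left.Opens} (i : U' ≤ U)
          (a : Γ((thickening 𝒳 (n + 1)).left, U)),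
          s.app U' ((thickening 𝒳 (n + 1)).left.presheaf.map (homOfLE i).op a) =
            (specialFibre 𝒳).left.presheaf.map
              (homOfLE (show s ⁻¹ᵁ U' ≤ s ⁻¹ᵁ U from fun q hq => i hq)).op (s.app U a) := by
        intro U U' i a
        rw [← CategoryTheory.comp_apply, ← CategoryTheory.comp_apply, s.naturality (homOfLE i).op]
        rfl
      have hxW : s ⁻¹ᵁ V ≤ cb.W z₀ :=
        (show s ⁻¹ᵁ V ≤ s ⁻¹ᵁ (ι ⁻¹ᵁ A x) from fun q hq => hle₁ x y hq).trans
          ((hAspec x _ hz₁).2 z₀ rfl)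
      have hyW : s ⁻¹ᵁ V ≤ cb.W z₀' :=
        (show s ⁻¹ᵁ V ≤ s ⁻¹ᵁ (ι ⁻¹ᵁ A y) from fun q hq => hle₂ x y hq).trans
          ((hAspec y _ hz₂).2 z₀' rfl)
      -- the images on `X_k` of the three factors
      have hLx : s.app V ((thickening 𝒳 (n + 1)).left.presheaf.map (homOfLE (hle₁ x y)).op (lam x)) =
          cb.lam z₀ (s ⁻¹ᵁ V) hxW := by
        rw [nats, hlamspec x z₀ hz₁, cb.map_lam]
      have hLy : s.app V ((thickening 𝒳 (n + 1)).left.presheaf.map (homOfLE (hle₂ x y)).op (lam y)) =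
          cb.lam z₀' (s ⁻¹ᵁ V) hyW := by
        rw [nats, hlamspec y z₀' hz₂, cb.map_lam]
      have hG : s.app V (g.g (s.base z₀) (s.base z₀') V ((hle₁ x y).trans (hAspec x _ hz₁).1)
          ((hle₂ x y).trans (hAspec y _ hz₂).1)) =
          (UnitCocycle.pullback s g).g z₀ z₀' (s ⁻¹ᵁ V)
            (fun q hq => (hle₁ x y).trans (hAspec x _ hz₁).1 hq)
            (fun q hq => (hle₂ x y).trans (hAspec y _ hz₂).1 hq) := by
        have hi : V ≤ g.U (s.base z₀) ⊓ g.U (s.base z₀') :=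
          le_inf ((hle₁ x y).trans (hAspec x _ hz₁).1) ((hle₂ x y).trans (hAspec y _ hz₂).1)
        rw [← g.map_g _ _ inf_le_left inf_le_right hi]
        change (((thickening 𝒳 (n + 1)).left.presheaf.map (homOfLE hi).op) ≫ s.app V) _ = _
        rw [Scheme.Hom.app_eq_appLE, Scheme.Hom.map_appLE]
        rfl
      -- the coboundary relation: `λ_{z₀} (s^*g)_{z₀ z₀'} = λ_{z₀'}`
      have e2 : cb.lam z₀ (s ⁻¹ᵁ V) hxW * (UnitCocycle.pullback s g).g z₀ z₀' (s ⁻¹ᵁ V)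
            (fun q hq => (hle₁ x y).trans (hAspec x _ hz₁).1 hq)
            (fun q hq => (hle₂ x y).trans (hAspec y _ hz₂).1 hq) = cb.lam z₀' (s ⁻¹ᵁ V) hyW :=
        UnitCocycle.coboundary_one_rel s g cb z₀ z₀' _ hxW hyW
      have e1 : s.app V (ι.app (A x ⊓ A y) (W x y)) = cb.lam z₀ (s ⁻¹ᵁ V) hxW *
          (UnitCocycle.pullback s g).g z₀ z₀' (s ⁻¹ᵁ V)
            (fun q hq => (hle₁ x y).trans (hAspec x _ hz₁).1 hq)
            (fun q hq => (hle₂ x y).trans (hAspec y _ hz₂).1 hq) *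
          s.app V ((thickening 𝒳 (n + 1)).left.presheaf.map (homOfLE (hle₂ x y)).op (laminv y)) := by
        rw [hWspec x y _ _ hz₁ hz₂, map_mul, map_mul, hLx, hG]
      have e3 : cb.lam z₀' (s ⁻¹ᵁ V) hyW *
          s.app V ((thickening 𝒳 (n + 1)).left.presheaf.map (homOfLE (hle₂ x y)).op (laminv y)) = 1 := by
        rw [← hLy, ← map_mul, ← map_mul, hmul_laminv, map_one, map_one]
      -- the value on `X_{n+1}` restricts to `1` on `X_k`
      have hone : s.app V (ι.app (A x ⊓ A y) (W x y) - 1) = 0 := by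
        rw [map_sub, map_one, e1, e2, e3, sub_self]
      obtain ⟨c, hc⟩ := exists_eq_p_mul_of_app_specialFibreToThickening_eq_zero 𝒳 n hVaffxy _ hone
      obtain ⟨C, hC⟩ := (thickeningι_cutOut 𝒳 (n + 1) (isAffineOpen_inf 𝒳 (hAaff x) (hAaff y))).1 c
      have hzero : ι.app (A x ⊓ A y) (W x y - 1 - (p : Γ(𝒳.left, A x ⊓ A y)) * C) = 0 := by
        rw [map_sub, map_sub, map_one, map_mul, map_natCast, hC, ← hc, sub_self]
      obtain ⟨D, hD⟩ := exists_eq_pow_mul_of_app_thickeningι_eq_zero 𝒳 (n + 1)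
        (isAffineOpen_inf 𝒳 (hAaff x) (hAaff y)) _ hzero
      refine ⟨C + (p : Γ(𝒳.left, A x ⊓ A y)) ^ n * D, ?_⟩
      linear_combination hD
    · refine ⟨0, ?_⟩
      rw [hWone x y (not_and_or.mp h), mul_zero, add_zero]
  · -- every cocycle built from the datum is cohomologous to `g` (coboundary `λ̂`)
    intro C hU hg
    symm
    refine CechPic.sound ⟨{
      W := fun z => ι ⁻¹ᵁ A (ι.base z)
      mem := fun z => hxA _
      le := fun z => (hAspec _ z rfl).1
      le' := fun z => (hU z).ge
      lam := fun z V hz => (thickening 𝒳 (n + 1)).left.presheaf.map (homOfLE hz).op (lam (ι.base z))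
      inv := fun z V hz => (thickening 𝒳 (n + 1)).left.presheaf.map (homOfLE hz).op (laminv (ι.base z))
      map_lam := fun z V V' hz i => res_res hz i _
      lam_mul_inv := fun z V hz => by rw [← map_mul, hmul_laminv, map_one]
      rel := fun z z' V hz hz' => ?_ }⟩
    have e : V ≤ ι ⁻¹ᵁ (A (ι.base z) ⊓ A (ι.base z')) := UnitCocycle.le_preimage_inf _ hz hz'
    rw [hg]
    change ((ι.app _ ≫ (thickening 𝒳 (n + 1)).left.presheaf.map (homOfLE e).op) _) * _ = _
    rw [CategoryTheory.comp_apply, hWspec _ _ z z' rfl rfl, map_mul, map_mul, res_res, res_res,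
      g.map_g, mul_assoc, ← map_mul, hlaminv_mul, map_one, mul_one]

/-- **Registered stub `stub_kernelPresentation` (P) of the weight-one-first skeleton** of
`PadicSemiregularLift.FormalLiftingFromClassLifting` (line `IdeatorFiveSketch`): a class on `X_{n+1}`
dying on the special fibre is presented by an affine datum `≡ 1 (mod p)` (closed form of
`exists_presentation_of_pullback_eq_one`). -/
theorem stub_kernelPresentation :
    ∀ (p : ℕ) [Fact p.Prime] (k : Type) [Field k] [CharP k p] [PerfectRing k p]
      (𝒳 : SchemeOver (WittVector p k)) [IsSeparated 𝒳.hom] (n : ℕ)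
      (u : CechPic (thickening 𝒳 (n + 1)).left),
      CechPic.pullback (specialFibreToThickening 𝒳 n) u = 1 →
      ∃ (A : 𝒳.left → 𝒳.left.Opens) (_ : ∀ x, x ∈ A x) (_ : ∀ x, IsAffineOpen (A x))
        (_ : ∀ x, x ∉ Set.range (thickeningι 𝒳 (n + 1)).base →
          ∀ q ∈ A x, q ∉ Set.range (thickeningι 𝒳 (n + 1)).base)
        (W : ∀ x y : 𝒳.left, Γ(𝒳.left, A x ⊓ A y)),
        (∀ x y z : 𝒳.left,
          (thickeningι 𝒳 (n + 1)).app (A x ⊓ A y ⊓ A z)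
            (𝒳.left.presheaf.map (homOfLE inf_le_left).op (W x y) *
              𝒳.left.presheaf.map
                (homOfLE (le_inf (inf_le_left.trans inf_le_right) inf_le_right)).op (W y z)) =
          (thickeningι 𝒳 (n + 1)).app (A x ⊓ A y ⊓ A z)
            (𝒳.left.presheaf.map
              (homOfLE (le_inf (inf_le_left.trans inf_le_left) inf_le_right)).op (W x z))) ∧
        (∀ x : 𝒳.left, (thickeningι 𝒳 (n + 1)).app (A x ⊓ A x) (W x x) = 1) ∧
        (∀ x y : 𝒳.left, ∃ w : Γ(𝒳.left, A x ⊓ A y),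
          W x y = 1 + (p : Γ(𝒳.left, A x ⊓ A y)) * w) ∧
        ∀ (C : UnitCocycle (thickening 𝒳 (n + 1)).left)
          (hU : ∀ z, C.U z = (thickeningι 𝒳 (n + 1)) ⁻¹ᵁ A ((thickeningι 𝒳 (n + 1)).base z)),
          (∀ (z z' : (thickening 𝒳 (n + 1)).left) (V : (thickening 𝒳 (n + 1)).left.Opens)
            (hz : V ≤ C.U z) (hz' : V ≤ C.U z'),
            C.g z z' V hz hz' = (thickeningι 𝒳 (n + 1)).appLE
              (A ((thickeningι 𝒳 (n + 1)).base z) ⊓ A ((thickeningι 𝒳 (n + 1)).base z')) V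
              (UnitCocycle.le_preimage_inf _ (hz.trans (hU z).le) (hz'.trans (hU z').le))
              (W ((thickeningι 𝒳 (n + 1)).base z) ((thickeningι 𝒳 (n + 1)).base z'))) →
          CechPic.mk C = u := by
  intro p _ k _ _ _ 𝒳 _ n u hu
  exact exists_presentation_of_pullback_eq_one 𝒳 n u hu

end

end Summit.HodgeConjecture.HodgeConjecture.Theorems.FormalLiftingFromClassLifting.WeightOne
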